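import Summits.AtomisticToContinuum.BoseEinsteinCondensation.Theorems.BECCutLineWeakDisorderTwoReplicaTransienceBoundFreeOneTools
import HarnessLib

/-!
# Crux `TwoReplicaTransienceBound` (stmt-AtomisticToContinuum-9687): free-gas case, II — the one-line
# participation ratio is bounded UNIFORMLY in the box and in the polymer length

Support file (does not close the item) for the crux
`Summit.AtomisticToContinuum.BoseEinsteinCondensation.Theses.BECCutLineWeakDisorder.TwoReplicaTransienceBound`
(route `BECCutLineWeakDisorder`, line `SketchIdeator1`, lead c2). For ONE Brownian line (speed `2`) killed on
the boundary of `Λ_L = (0,L)³`, with survival probability `θ_T(x) = Z^{(1)}_T(x)` (`fkPartition` at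
`N = 1`), the participation ratio of the survival profile is bounded by an ABSOLUTE constant:

  `L³ ∫ θ_T² / (∫ θ_T)² ≤ C`   for all `L > 0` and all `T ≥ 0`   (`free_ratio_le`)

— the number the crux's integral equals for the free gas at every particle number
(`…TwoReplicaTransienceBoundFreeGas.lean`). Scale-free proof at the diffusive scale `h = L²/1920`
(tools: `…FreeOneTools.lean`):

* short times `T ≤ 2h`: `θ_T ≥ q₀ = 1 - 6e⁻⁵` on the middle cube `(L/4, 3L/4)³`, so `∫θ_T ≥ q₀ (L/2)³` and,
  as `θ ≤ 1`, the ratio is `≤ L³/∫θ_T ≤ 8/q₀`;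
* long times `T ≥ h`: `θ_T(x)²·‖θ_{2h}‖₂² ≤ κ_h ‖θ_0‖₂² ‖θ_T‖₂²` (`fkSemigroup_one_sq_mul_le`: smoothing over
  one diffusive step + the log-convexity ladder), `κ_h = (4πh)^{-3/2} = (cL)⁻³`, `‖θ_0‖₂² ≤ L³`,
  `‖θ_{2h}‖₂² ≥ q₀² (L/2)³`; so `θ_T ≤ √B` with `B = κ_h L³ ‖θ_T‖₂²/(q₀²(L/2)³)`, `‖θ_T‖₂² ≤ √B ‖θ_T‖₁`, and
  the ratio is `≤ 8/(c³ q₀²)`, `c = √(π/480)`. Every `L` cancels.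

## References

* K. L. Chung, Z. Zhao, *From Brownian Motion to Schrödinger's Equation* (1995), Thm 3.17
  (`T_t : L² → L^∞`). [ChungZhao1995]
-/

noncomputable section

open MeasureTheory Filter Set Metric
open scoped ENNReal NNReal Topology

namespace Summit.AtomisticToContinuum.BoseEinsteinCondensation.Cruxes.TwoReplicaTransienceBound.FreeGas

open Literature.MathematicalPhysics.QuantumManyBody.BoseGas
open Summit.AtomisticToContinuum.BoseEinsteinCondensation.Theorems.CutLineWitness

/-! ### The one-line participation ratio, uniformly in `L` and `T` -/

/-- **The free one-line participation ratio is bounded by an absolute constant**: there is `C < ∞` such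
that for every measurable `v` (irrelevant for one line), every `L > 0` and every `T ≥ 0`,
`L³ ∫ Z^{(1)}_T(x)² dx / (∫ Z^{(1)}_T(x) dx)² ≤ C`, `Z^{(1)}_T(x) = P_x(τ_{Λ_L} > T)` the Dirichlet survival
probability of one Brownian line (speed `2`). Short times by the survival floor `q₀` on the middle cube,
long times by the `L² → L^∞` smoothing over one diffusive step `h = L²/1920` and the log-convexity ladder;
all lengths cancel. [cite: ChungZhao1995, Thm 3.17] -/
theorem free_ratio_le : ∃ C : ℝ≥0∞, C ≠ ⊤ ∧ ∀ (v : ℝ → ℝ≥0∞), Measurable v → ∀ L : ℝ, 0 < L →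
    ∀ T : ℝ, 0 ≤ T →
      ENNReal.ofReal (L ^ 3) * (∫⁻ x, fkPartition (N := 1) v L T (fun _ => x) ^ 2) /
        (∫⁻ x, fkPartition (N := 1) v L T (fun _ => x)) ^ 2 ≤ C := by
  -- the two absolute constants
  set q : ℝ := 1 - 6 * Real.exp (-5) with hq
  have hq0 : 0 < q := q0_pos
  set c : ℝ := Real.sqrt (Real.pi / 480) with hc
  have hc0 : 0 < c := Real.sqrt_pos.2 (by positivity)
  set C₁ : ℝ := 8 / q with hC₁
  set C₂ : ℝ := 8 / (c ^ 3 * q ^ 2) with hC₂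
  refine ⟨ENNReal.ofReal C₁ + ENNReal.ofReal C₂, by simp, fun v hv L hL T hT0 => ?_⟩
  -- notation
  set θ : ℝ → Space → ℝ≥0∞ := fun s x => fkPartition (N := 1) v L s (fun _ => x) with hθ
  set M : Set Space := {x : Space | ∀ k, x k ∈ Set.Ioo (L / 4) (3 * L / 4)} with hM
  have hMm : MeasurableSet M := measurableSet_middle L
  have hVM : volume M = ENNReal.ofReal ((L / 2) ^ 3) := by
    rw [hM, volume_middle, ENNReal.ofReal_pow (by positivity)]
  have hV0 : volume M ≠ 0 := by rw [hVM]; exact (ENNReal.ofReal_pos.2 (by positivity)).ne'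
  have hVt : volume M ≠ ⊤ := by rw [hVM]; exact ENNReal.ofReal_ne_top
  have hθm : ∀ s, Measurable (θ s) := fun s => measurable_fkPartition_one hv L s
  have hθ1 : ∀ s x, θ s x ≤ 1 := fun s x => fkPartition_le_one v L s _
  set s₀ : ℝ := L ^ 2 / 960 with hs₀
  have hs₀0 : 0 < s₀ := by positivity
  -- floor on the middle cube for times `≤ s₀`
  have hfloor : ∀ s, 0 ≤ s → s ≤ s₀ → ∀ x ∈ M, ENNReal.ofReal q ≤ θ s x := fun s hs hss x hx =>
    fkPartition_one_ge_on_middle hv hL hx hs hss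
  -- hence `∫ θ_s ≥ q |M|` and `∫ θ_s² ≥ q² |M|` for `s ≤ s₀`
  have hint1 : ∀ s, 0 ≤ s → s ≤ s₀ → ENNReal.ofReal q * volume M ≤ ∫⁻ x, θ s x := by
    intro s hs hss
    calc ENNReal.ofReal q * volume M = ∫⁻ x in M, ENNReal.ofReal q := (setLIntegral_const _ _).symm
      _ ≤ ∫⁻ x in M, θ s x := setLIntegral_mono (hθm s) fun x hx => hfloor s hs hss x hx
      _ ≤ ∫⁻ x, θ s x := setLIntegral_le_lintegral _ _
  have hint2 : ENNReal.ofReal q ^ 2 * volume M ≤ ∫⁻ x, θ s₀ x ^ 2 := by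
    calc ENNReal.ofReal q ^ 2 * volume M = ∫⁻ x in M, ENNReal.ofReal q ^ 2 := (setLIntegral_const _ _).symm
      _ ≤ ∫⁻ x in M, θ s₀ x ^ 2 :=
          setLIntegral_mono ((hθm s₀).pow_const 2) fun x hx => pow_le_pow_left' (hfloor s₀ hs₀0.le le_rfl x hx) 2
      _ ≤ ∫⁻ x, θ s₀ x ^ 2 := setLIntegral_le_lintegral _ _
  rcases le_total T s₀ with hTs | hTs
  · -- SHORT TIMES: `ratio ≤ L³ / ∫θ_T ≤ 8/q`
    refine le_add_right ?_
    set I₁ := ∫⁻ x, θ T x with hI₁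
    set I₂ := ∫⁻ x, θ T x ^ 2 with hI₂
    have hI21 : I₂ ≤ I₁ := lintegral_mono fun x => by
      calc θ T x ^ 2 = θ T x * θ T x := sq _
        _ ≤ 1 * θ T x := mul_le_mul' (hθ1 T x) le_rfl
        _ = θ T x := one_mul _
    have hI1pos : ENNReal.ofReal q * volume M ≤ I₁ := hint1 T hT0 hTs
    have hI10 : I₁ ≠ 0 := fun h0 => by
      rw [h0, nonpos_iff_eq_zero, mul_eq_zero] at hI1pos
      rcases hI1pos with h | h
      · exact (ENNReal.ofReal_pos.2 hq0).ne' h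
      · exact hV0 h
    have hI1t : I₁ ≠ ⊤ := by
      refine ne_top_of_le_ne_top (ENNReal.mul_ne_top ENNReal.one_ne_top (volume_box_ne_top L)) ?_
      calc I₁ ≤ ∫⁻ x, (box L).indicator 1 x := lintegral_mono fun x => by
              by_cases hxb : x ∈ box L
              · rw [Set.indicator_of_mem hxb]; exact hθ1 T x
              · rw [Set.indicator_of_notMem hxb, hθ]
                have : (fun _ : Fin 1 => x) ∉ boxN 1 L := fun h => hxb (h 0)
                simp [fkPartition, fkSemigroup_of_notMem v hT0 _ this]
        _ = 1 * volume (box L) := by rw [lintegral_indicator_one (measurableSet_box L), one_mul]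
    calc ENNReal.ofReal (L ^ 3) * I₂ / I₁ ^ 2
        ≤ ENNReal.ofReal (L ^ 3) * I₁ / I₁ ^ 2 := by gcongr
      _ = ENNReal.ofReal (L ^ 3) / I₁ := by rw [sq, ENNReal.mul_div_mul_right _ _ hI10 hI1t]
      _ ≤ ENNReal.ofReal (L ^ 3) / (ENNReal.ofReal q * volume M) := ENNReal.div_le_div_left hI1pos _
      _ = ENNReal.ofReal C₁ := by
          rw [hVM, ← ENNReal.ofReal_mul hq0.le, ← ENNReal.ofReal_div_of_pos (by positivity), hC₁]
          congr 1
          field_simp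
          ring
  · -- LONG TIMES: smoothing over one step `h = s₀/2` and the ladder
    refine le_add_left ?_
    set h : ℝ := L ^ 2 / 1920 with hh
    have hh0 : 0 < h := by positivity
    have h2h : 2 * h = s₀ := by rw [hh, hs₀]; ring
    have hhT : h ≤ T := by linarith
    set I₁ := ∫⁻ x, θ T x with hI₁
    set I₂ := ∫⁻ x, θ T x ^ 2 with hI₂
    -- `κ = (4πh)^{-3/2} = (c L)⁻³`
    set κ : ℝ≥0∞ := (∏ _i : Fin 1, ∏ _k : Fin 3,
      ENNReal.ofReal (Real.sqrt (2 * Real.pi * (2 * h.toNNReal)))⁻¹) with hκ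
    have hcL : Real.sqrt (2 * Real.pi * (2 * h.toNNReal)) = c * L := by
      rw [Real.coe_toNNReal _ hh0.le, hh, hc, show 2 * Real.pi * (2 * (L ^ 2 / 1920)) = Real.pi / 480 * L ^ 2 by ring,
        Real.sqrt_mul (by positivity), Real.sqrt_sq hL.le]
    have hκeq : κ = ENNReal.ofReal ((c * L)⁻¹ ^ 3) := by
      rw [hκ, hcL, Finset.prod_const, Finset.prod_const, Finset.card_univ, Finset.card_univ,
        Fintype.card_fin, Fintype.card_fin, pow_one, ENNReal.ofReal_pow (by positivity)]
    -- norms: `𝒩_T = I₂`, `𝒩_0 ≤ L³`, `𝒩_{2h} ≥ q² |M|`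
    have hNT : fkNormSq (N := 1) v L T (fun _ => (1 : ℝ≥0∞)) = I₂ := fkNormSq_one_config_one v L T
    have hN0 : fkNormSq (N := 1) v L 0 (fun _ => (1 : ℝ≥0∞)) ≤ ENNReal.ofReal (L ^ 3) := by
      refine (fkNormSq_one_le v le_rfl).trans_eq ?_
      rw [volume_boxN, pow_one, ENNReal.ofReal_pow hL.le]
    have hN2 : ENNReal.ofReal q ^ 2 * volume M ≤ fkNormSq (N := 1) v L (2 * h) (fun _ => (1 : ℝ≥0∞)) := by
      rw [h2h, fkNormSq_one_config_one v L s₀]; exact hint2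
    have hN2pos : ENNReal.ofReal q ^ 2 * volume M ≠ 0 :=
      mul_ne_zero (pow_ne_zero _ (ENNReal.ofReal_pos.2 hq0).ne') hV0
    -- the sup bound: `θ_T(x)² · 𝒩_{2h} ≤ κ 𝒩_0 I₂`
    have hsup : ∀ x, θ T x ^ 2 * (ENNReal.ofReal q ^ 2 * volume M) ≤ κ * ENNReal.ofReal (L ^ 3) * I₂ := by
      intro x
      calc θ T x ^ 2 * (ENNReal.ofReal q ^ 2 * volume M)
          ≤ θ T x ^ 2 * fkNormSq (N := 1) v L (2 * h) (fun _ => (1 : ℝ≥0∞)) := mul_le_mul' le_rfl hN2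
        _ ≤ κ * (fkNormSq (N := 1) v L 0 (fun _ => (1 : ℝ≥0∞)) * fkNormSq (N := 1) v L T (fun _ => 1)) :=
            fkSemigroup_one_sq_mul_le (N := 1) hv L hh0 hhT _
        _ ≤ κ * (ENNReal.ofReal (L ^ 3) * I₂) := by rw [hNT]; gcongr
        _ = κ * ENNReal.ofReal (L ^ 3) * I₂ := (mul_assoc _ _ _).symm
    -- `B := κ L³ I₂ / (q²|M|)` bounds `θ_T²`; its square root bounds `θ_T`
    set B : ℝ≥0∞ := κ * ENNReal.ofReal (L ^ 3) * I₂ / (ENNReal.ofReal q ^ 2 * volume M) with hB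
    have hθB : ∀ x, θ T x ^ 2 ≤ B := fun x =>
      (ENNReal.le_div_iff_mul_le (Or.inl hN2pos) (Or.inl (ENNReal.mul_ne_top
        (ENNReal.pow_ne_top ENNReal.ofReal_ne_top) hVt))).2 (hsup x)
    have hθb : ∀ x, θ T x ≤ B ^ ((2 : ℕ)⁻¹ : ℝ) := fun x => by
      have := ENNReal.rpow_le_rpow (hθB x) (z := ((2 : ℕ)⁻¹ : ℝ)) (by positivity)
      rwa [ENNReal.pow_rpow_inv_natCast two_ne_zero] at this
    have hI2le : I₂ ≤ B ^ ((2 : ℕ)⁻¹ : ℝ) * I₁ := by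
      rw [hI₁, ← lintegral_const_mul' _ _ ?_]
      · exact lintegral_mono fun x => by rw [sq]; exact mul_le_mul' (hθb x) le_rfl
      · refine ENNReal.rpow_ne_top_of_nonneg (by positivity) ?_
        refine (ENNReal.div_lt_top (ENNReal.mul_ne_top (ENNReal.mul_ne_top ?_ ENNReal.ofReal_ne_top) ?_)
          hN2pos).ne
        · rw [hκeq]; exact ENNReal.ofReal_ne_top
        · rw [← hNT]; exact ne_top_of_le_ne_top (volume_boxN_lt_top 1 L).ne (fkNormSq_one_le v hT0)
    have hI2sq : I₂ ^ 2 ≤ B * I₁ ^ 2 := by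
      calc I₂ ^ 2 ≤ (B ^ ((2 : ℕ)⁻¹ : ℝ) * I₁) ^ 2 := pow_le_pow_left' hI2le 2
        _ = B * I₁ ^ 2 := by rw [mul_pow, ENNReal.rpow_inv_natCast_pow two_ne_zero]
    -- conclude: `L³ I₂ / I₁² ≤ L³ κ L³ / (q² |M|) = C₂`
    rcases eq_or_ne I₂ 0 with hI20 | hI20
    · simp [hI20]
    have hI2t : I₂ ≠ ⊤ := by
      rw [← hNT]; exact ne_top_of_le_ne_top (volume_boxN_lt_top 1 L).ne (fkNormSq_one_le v hT0)
    -- cancel one `I₂`: `I₂ ≤ (κ L³ / (q²|M|)) · I₁²`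
    set K : ℝ≥0∞ := κ * ENNReal.ofReal (L ^ 3) / (ENNReal.ofReal q ^ 2 * volume M) with hK
    have hBK : B = K * I₂ := by
      rw [hB, hK, ENNReal.mul_div_right_comm]
    have hI2K : I₂ ≤ K * I₁ ^ 2 := by
      have h1 : I₂ * I₂ ≤ I₂ * (K * I₁ ^ 2) := by
        calc I₂ * I₂ = I₂ ^ 2 := (sq _).symm
          _ ≤ B * I₁ ^ 2 := hI2sq
          _ = I₂ * (K * I₁ ^ 2) := by rw [hBK]; ring
      exact (ENNReal.mul_le_mul_iff_right hI20 hI2t).1 h1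
    have hKeq : ENNReal.ofReal (L ^ 3) * K = ENNReal.ofReal C₂ := by
      rw [hK, hκeq, hVM, ← ENNReal.ofReal_pow hq0.le, ← ENNReal.ofReal_mul (by positivity),
        ← ENNReal.ofReal_mul (by positivity), ← mul_div_assoc, ← ENNReal.ofReal_mul (by positivity),
        ← ENNReal.ofReal_div_of_pos (by positivity), hC₂]
      congr 1
      field_simp
      ring
    calc ENNReal.ofReal (L ^ 3) * I₂ / I₁ ^ 2
        ≤ ENNReal.ofReal (L ^ 3) * (K * I₁ ^ 2) / I₁ ^ 2 := by gcongr
      _ = ENNReal.ofReal (L ^ 3) * K * (I₁ ^ 2 / I₁ ^ 2) := by rw [← mul_assoc, mul_div_assoc]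
      _ ≤ ENNReal.ofReal (L ^ 3) * K * 1 := by gcongr; exact ENNReal.div_self_le_one
      _ = ENNReal.ofReal C₂ := by rw [mul_one, hKeq]

end Summit.AtomisticToContinuum.BoseEinsteinCondensation.Cruxes.TwoReplicaTransienceBound.FreeGas

namespace Summit.AtomisticToContinuum.BoseEinsteinCondensation.Cruxes.TwoReplicaTransienceBound.TracerDecoupling

open Literature.MathematicalPhysics.QuantumManyBody.BoseGas

/-- **Registered toolbox stub `stub_freeRatio`** (crux stmt-AtomisticToContinuum-9687, line `SketchIdeator1`):
the participation ratio `L³∫θ_T²/(∫θ_T)²` of the one-line Dirichlet survival profile `θ_T = Z^{(1)}_T` is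
bounded by ONE finite constant for all `L > 0` and all `T ≥ 0` (`= FreeGas.free_ratio_le`). -/
theorem stub_freeRatio :
    ∃ C : ENNReal, C ≠ ⊤ ∧ ∀ (v : ℝ → ENNReal), Measurable v → ∀ (L : ℝ), 0 < L → ∀ (T : ℝ), 0 ≤ T →
      ENNReal.ofReal (L ^ 3) * (∫⁻ x, @fkPartition 1 v L T (fun _ => x) ^ 2) /
        (∫⁻ x, @fkPartition 1 v L T (fun _ => x)) ^ 2 ≤ C :=
  FreeGas.free_ratio_le

end Summit.AtomisticToContinuum.BoseEinsteinCondensation.Cruxes.TwoReplicaTransienceBound.TracerDecoupling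

end
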